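import Summits.ValiantsHypothesis.ValiantsHypothesis.Theorems.NNDivisionHard.Negative.RealLambdaCone
import Summits.ValiantsHypothesis.ValiantsHypothesis.Theorems.NNDivisionHard.Negative.WeakReliefBlindPermutahedron

/-!
# Real-λ blindness of the located permutahedron pencil, part 2a (§3; §5 = sibling file `RealLambdaPencil.lean`, split for the 400-line lint): ★★★ `real_rankPlus_le` — `(1 − |a∩b|)² + λ·inv(a;π)` is clique-BLIND at EVERY fixed real `λ > 0`;
# in the tree's currency ★★★ `hasNonnegFactorization_pencil_poly : HasNonnegFactorization (pencil n λ) ((n+1)^(4T+1))` (`λT ≥ 2`)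

PORT NOTE (staged by the AUTHOR val-idea-39 g5 for the Negative-lane port pool; critic of record val-idea-crit-9 g3, V#111c booked rev 2 «KERNEL VERIFIED: S2 ANSWERED, no λ_c»): texts VERBATIM BY NAME from the crux workfile `Cruxes/NNDivisionHard/RealLambda39.lean` rev 4 @311ce0a993de (sha16 ce0b080758a4c26c,
farm rc 0 / 0 sorries / 0 warnings), memo `Cruxes/NNDivisionHard/RealLambda39.md` rev 2 @19a32fa804d9.  Deltas vs the workfile: namespace `…Theorems.NNDivisionHardNegative.RealLambda` (sibling of `…WeakReliefBlind`), split into three parts (§1–§2 / §3+§5 / §4), this header.  CENSUS / CALIBRATION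
theorems about ONE certificate family (conjunctions of boundedly many literals on a size class); no item closes; VP ≠ VNP is NOT proved; the crux `NNDivisionHard` (stmt-ValiantsHypothesis-21181) stays OPEN; nothing here bears on its status.

THEOREM T1 of the memo (uniform strategy, degree `2T` for any natural `T` with `λT ≥ 2`): for every real `λ > 0`, every `n`, every row `a ⊆ [n]` and every column `(b, π)`, `(1 − |a∩b|)² + λ·inv(a;π) = Σ_s U a s · V (b,π) s` with `U, V ≥ 0` over the slot type `Fin (n+1) × (Finset (Fin n) × Finset (Fin n))`,
where the row factor `U a (k, S, T′) = [|a| = k]·[|S|+|T′| ≤ 2T]·[S ⊆ a][T′ ∩ a = ∅]` is a CONJUNCTION OF AT MOST `2T` LITERALS — so at most `(n+1)·Σ_{d ≤ 2T} 2^d·C(n,d) = n^{O(1/λ)}` slots are live: the clique rows are blind to `Q^Π_λ` at every constant dilation, there is no `λ_c > 0`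
(question S2 of the W7 memo `SmallLambda39.md` §6).  The integer theorem `…WeakReliefBlind.inv_rankPlus_le` (`λ ≥ 1`, `O(n³)` slots) is the small-degree end of the same picture.  Ingredients: `inv_cast`/`χ_trich`, the slice identities `inv_I1` (insider count) / `inv_I2` (outsider count) for a GENERAL permutation on
the slice `|a| = k`, the column identity `col_eq` (column = `cubeF (posLT π k) ((λ/2)·dist) b 0 + slack`, `slack` an explicit degree-2 cone element), the near-set bound `near_card` (`≤ 2T−2` elements of `b` at distance `< 2/λ` from the cut), `col_inCone` (degree `2T`), `col_cert`, and the packaging.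
§5: the same bound as `Literature.Combinatorics.Optimization.HasNonnegFactorization (pencil n λ) N` — slot form `N = #LiveSlot n T` and the explicit polynomial `N = (n+1)^(4T+1)` (`card_subsets_le : #{S ⊆ [n] : |S| ≤ D} ≤ (n+1)^D`, `card_liveSlot_le`), i.e. `rank₊ M_λ^{(n)} ≤ (n+1)^{4⌈2/λ⌉+1}`.
-/

-- the mandated summit-side namespace repeats a component by design (single-problem summit)
set_option linter.dupNamespace false
namespace Summit.ValiantsHypothesis.Theorems.NNDivisionHardNegative.RealLambda
open Finset
open Summit.ValiantsHypothesis.Theorems.NNDivisionHardNegative.BlindCubeIdentity (ind)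
open Summit.ValiantsHypothesis.Theorems.NNDivisionHardNegative.WeakReliefBlind (posLT invInd inv card_posLT)

noncomputable section
variable {n : ℕ}

/-! ## §3 Slice transfer (identities I1 / I2 for a general permutation) and packaging -/

section Slice
variable (π : Equiv.Perm (Fin n))

/-- inversion indicator over `ℝ`: `χ l l′ = [π(l′) < π(l)]` -/
def χ (l l' : Fin n) : ℝ := if π l' < π l then 1 else 0

/-- Port helper `inv_cast` (statement and proof verbatim from the crux workfile; see the file header). -/
theorem inv_cast (a : Finset (Fin n)) : (inv a π : ℝ) = ∑ l, ∑ l', X a l * (1 - X a l') * χ π l l' := by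
  simp only [inv, ind, invInd, X, χ]
  push_cast
  rfl

/-- trichotomy: `[π l′ < π l] + [π l < π l′] + [l = l′] = 1` -/
theorem χ_trich (l l' : Fin n) : χ π l l' + χ π l' l + (if l = l' then (1:ℝ) else 0) = 1 := by
  unfold χ
  by_cases h1 : π l' < π l
  · have h2 : ¬ π l < π l' := lt_asymm h1
    have h3 : l ≠ l' := fun h => by subst h; exact lt_irrefl _ h1
    simp [h1, h2, h3]
  · by_cases h2 : π l < π l'
    · have h3 : l ≠ l' := fun h => by subst h; exact lt_irrefl _ h2
      simp [h1, h2, h3]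
    · have h3 : l = l' := π.injective (le_antisymm (not_lt.mp h1) (not_lt.mp h2))
      simp [h3]

/-- Port helper `sum_X_univ` (statement and proof verbatim from the crux workfile; see the file header). -/
theorem sum_X_univ (a : Finset (Fin n)) : ∑ l, X a l = (a.card : ℝ) := by
  rw [sum_X]; simp

/-- `#{l : π l < π l′} = π l′` -/
theorem card_filter_lt (l' : Fin n) :
    (((Finset.univ.filter fun l : Fin n => π l < π l').card : ℕ) : ℝ) = ((π l' : ℕ) : ℝ) := by
  have h : (Finset.univ.filter fun l : Fin n => π l < π l') = posLT π (π l' : ℕ) := by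
    ext l
    simp only [posLT, Finset.mem_filter, Finset.mem_univ, true_and]
    exact Fin.lt_def
  rw [h, card_posLT π (π l').isLt.le]

/-- Port helper `sum_` (statement and proof verbatim from the crux workfile; see the file header). -/
theorem sum_χ (l : Fin n) : ∑ l', χ π l l' = ((π l : ℕ) : ℝ) := by
  unfold χ
  rw [Finset.sum_boole]
  exact card_filter_lt π l

/-- `Σ_l X_l [π l′ < π l] = k − X_{l′} − Σ_l X_l [π l < π l′]` on the slice `|a| = k` -/
theorem sum_Xχ_flip {k : ℕ} {a : Finset (Fin n)} (hk : a.card = k) (l' : Fin n) :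
    ∑ l, X a l * χ π l l' = (k : ℝ) - X a l' - ∑ l, X a l * χ π l' l := by
  classical
  have hka : ∑ l, X a l = (k : ℝ) := by rw [sum_X_univ, hk]
  have e : ∀ l, X a l * χ π l l' = X a l - X a l * χ π l' l - X a l * (if l = l' then 1 else 0) := by
    intro l
    have h := χ_trich π l l'
    linear_combination (X a l) * h
  rw [Finset.sum_congr rfl (fun l _ => e l), Finset.sum_sub_distrib, Finset.sum_sub_distrib, hka]
  simp only [mul_ite, mul_one, mul_zero, Finset.sum_ite_eq', Finset.mem_univ, if_true]
  ring

/-- `Σ_l X_l [π l < π l′] = Σ_{j : π j < π l′} X_j` -/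
theorem sum_Xχ_filter (a : Finset (Fin n)) (l' : Fin n) :
    ∑ l, X a l * χ π l' l = ∑ j ∈ Finset.univ.filter (fun j => π j < π l'), X a j := by
  rw [Finset.sum_filter]
  exact Finset.sum_congr rfl fun l _ => by unfold χ; split_ifs <;> ring

/-- `Σ_{l′} X_{l′} [π l < π l′] = Σ_{j : π l < π j} X_j` -/
theorem sum_Xχ_filter' (a : Finset (Fin n)) (l : Fin n) :
    ∑ l', X a l' * χ π l' l = ∑ j ∈ Finset.univ.filter (fun j => π l < π j), X a j := by
  rw [Finset.sum_filter]
  exact Finset.sum_congr rfl fun l' _ => by unfold χ; split_ifs <;> ring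

/-- IDENTITY I1 on the slice `|a| = k` (insider-side count of the inversions):
`inv(a;π) = Σ_{l′ ∈ P} (k − π l′)(1 − X_{l′}) + Σ_{l′ ∈ P} Σ_{π j < π l′} (1 − X_j)(1 − X_{l′}) + Σ_{l′ ∉ P} Σ_{π l′ < π l} (1 − X_{l′}) X_l`,
`P = posLT π k`. -/
theorem inv_I1 {k : ℕ} {a : Finset (Fin n)} (hk : a.card = k) :
    (inv a π : ℝ) =
      ∑ l' ∈ posLT π k, ((k : ℝ) - ((π l' : ℕ) : ℝ)) * (1 - X a l') +
      ∑ l' ∈ posLT π k, ∑ j ∈ Finset.univ.filter (fun j => π j < π l'), (1 - X a j) * (1 - X a l') +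
      ∑ l' ∈ Finset.univ.filter (fun l' : Fin n => ¬ ((π l' : ℕ) < k)),
        ∑ l ∈ Finset.univ.filter (fun l => π l' < π l), (1 - X a l') * X a l := by
  classical
  have partA : ∀ l' : Fin n, ∑ l, X a l * (1 - X a l') * χ π l l' =
      ∑ l ∈ Finset.univ.filter (fun l => π l' < π l), (1 - X a l') * X a l := by
    intro l'
    rw [Finset.sum_filter]
    refine Finset.sum_congr rfl fun l _ => ?_
    unfold χ; split_ifs <;> ring
  have partB : ∀ l' : Fin n, ∑ l, X a l * (1 - X a l') * χ π l l' =
      ((k : ℝ) - ((π l' : ℕ) : ℝ)) * (1 - X a l') +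
        ∑ j ∈ Finset.univ.filter (fun j => π j < π l'), (1 - X a j) * (1 - X a l') := by
    intro l'
    have e0 : ∑ l, X a l * (1 - X a l') * χ π l l' = (1 - X a l') * ∑ l, X a l * χ π l l' := by
      rw [Finset.mul_sum]; exact Finset.sum_congr rfl fun l _ => by ring
    have h2 : ∑ j ∈ Finset.univ.filter (fun j => π j < π l'), X a j = ((π l' : ℕ) : ℝ) -
        ∑ j ∈ Finset.univ.filter (fun j => π j < π l'), (1 - X a j) := by
      rw [Finset.sum_sub_distrib, Finset.sum_const, nsmul_eq_mul, mul_one, card_filter_lt]; ring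
    rw [e0, sum_Xχ_flip π hk, sum_Xχ_filter, h2]
    have hx := X_mul_self a l'
    have : (1 - X a l') * ((k:ℝ) - X a l' - (((π l' : ℕ) : ℝ) -
        ∑ j ∈ Finset.univ.filter (fun j => π j < π l'), (1 - X a j)))
        = ((k : ℝ) - ((π l' : ℕ) : ℝ)) * (1 - X a l') +
          (1 - X a l') * ∑ j ∈ Finset.univ.filter (fun j => π j < π l'), (1 - X a j) -
          (X a l' - X a l' * X a l') := by ring
    rw [this, hx, sub_self, sub_zero, Finset.mul_sum]
    congr 1
    exact Finset.sum_congr rfl fun j _ => by ring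
  rw [inv_cast, Finset.sum_comm,
    ← Finset.sum_filter_add_sum_filter_not Finset.univ (fun l' : Fin n => ((π l' : ℕ)) < k)]
  congr 1
  · rw [← Finset.sum_add_distrib]
    exact Finset.sum_congr rfl fun l' _ => partB l'
  · exact Finset.sum_congr rfl fun l' _ => partA l'

/-- IDENTITY I2 on the slice `|a| = k` (outsider-side count of the inversions): `inv(a;π) = Σ_{l ∉ P} (π l + 1 − k) X_l + Σ_{l ∉ P} Σ_{π l < π j} X_l X_j + Σ_{l ∈ P} Σ_{π j < π l} X_l (1 − X_j)`. -/
theorem inv_I2 {k : ℕ} {a : Finset (Fin n)} (hk : a.card = k) :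
    (inv a π : ℝ) =
      ∑ l ∈ Finset.univ.filter (fun l : Fin n => ¬ ((π l : ℕ) < k)), ((((π l : ℕ) : ℝ) + 1 - k) * X a l) +
      ∑ l ∈ Finset.univ.filter (fun l : Fin n => ¬ ((π l : ℕ) < k)),
        ∑ j ∈ Finset.univ.filter (fun j => π l < π j), X a l * X a j +
      ∑ l ∈ posLT π k, ∑ j ∈ Finset.univ.filter (fun j => π j < π l), X a l * (1 - X a j) := by
  classical
  have e : ∀ l, ∑ l', X a l * (1 - X a l') * χ π l l' = X a l * ∑ l', (1 - X a l') * χ π l l' := by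
    intro l; rw [Finset.mul_sum]; exact Finset.sum_congr rfl fun l' _ => by ring
  have partD : ∀ l, X a l * ∑ l', (1 - X a l') * χ π l l' =
      ∑ j ∈ Finset.univ.filter (fun j => π j < π l), X a l * (1 - X a j) := by
    intro l
    rw [Finset.mul_sum, Finset.sum_filter]
    exact Finset.sum_congr rfl fun l' _ => by unfold χ; split_ifs <;> ring
  have partC : ∀ l, X a l * ∑ l', (1 - X a l') * χ π l l' =
      (((π l : ℕ) : ℝ) + 1 - k) * X a l + ∑ j ∈ Finset.univ.filter (fun j => π l < π j), X a l * X a j := by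
    intro l
    have h1 : ∑ l', (1 - X a l') * χ π l l' = ((π l : ℕ) : ℝ) - ∑ l', X a l' * χ π l l' := by
      have : ∀ l', (1 - X a l') * χ π l l' = χ π l l' - X a l' * χ π l l' := fun l' => by ring
      rw [Finset.sum_congr rfl (fun l' _ => this l'), Finset.sum_sub_distrib, sum_χ]
    have h2 : ∑ l', X a l' * χ π l l' = (k : ℝ) - X a l - ∑ l', X a l' * χ π l' l := by
      have := sum_Xχ_flip π hk l
      linarith
    rw [h1, h2, sum_Xχ_filter']
    have hx := X_mul_self a l
    have : X a l * (((π l : ℕ) : ℝ) - ((k : ℝ) - X a l -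
        ∑ j ∈ Finset.univ.filter (fun j => π l < π j), X a j))
        = (((π l : ℕ) : ℝ) + 1 - k) * X a l + X a l * ∑ j ∈ Finset.univ.filter (fun j => π l < π j), X a j
          - (X a l - X a l * X a l) := by ring
    rw [this, hx, sub_self, sub_zero, Finset.mul_sum]
  rw [inv_cast, Finset.sum_congr rfl (fun l _ => e l),
    ← Finset.sum_filter_add_sum_filter_not Finset.univ (fun l : Fin n => ((π l : ℕ)) < k), add_comm]
  congr 1
  · rw [← Finset.sum_add_distrib]
    exact Finset.sum_congr rfl fun l _ => partC l
  · exact Finset.sum_congr rfl fun l _ => partD l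

end Slice

section Column
variable (lam : ℝ) (π : Equiv.Perm (Fin n)) (k : ℕ) (b : Finset (Fin n))

/-- the reliefs `(λ/2)·dist(u)`: `dist = k − π u` for insiders (`π u < k`), `π u + 1 − k` for outsiders -/
def relief (u : Fin n) : ℝ :=
  if (π u : ℕ) < k then lam / 2 * ((k : ℝ) - ((π u : ℕ) : ℝ)) else lam / 2 * (((π u : ℕ) : ℝ) + 1 - k)

/-- the explicit degree-2 slack of the slice transfer (`θ = ½`): `(λ/2)(R₁ + R₂)` plus the reliefs of the elements NOT in `b` -/
def slack (a : Finset (Fin n)) : ℝ :=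
  lam / 2 * (∑ l' ∈ posLT π k, ∑ j ∈ Finset.univ.filter (fun j => π j < π l'), (1 - X a j) * (1 - X a l') +
    ∑ l' ∈ Finset.univ.filter (fun l' : Fin n => ¬ ((π l' : ℕ) < k)),
      ∑ l ∈ Finset.univ.filter (fun l => π l' < π l), (1 - X a l') * X a l) +
  lam / 2 * (∑ l ∈ Finset.univ.filter (fun l : Fin n => ¬ ((π l : ℕ) < k)),
      ∑ j ∈ Finset.univ.filter (fun j => π l < π j), X a l * X a j +
    ∑ l ∈ posLT π k, ∑ j ∈ Finset.univ.filter (fun j => π j < π l), X a l * (1 - X a j)) +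
  lam / 2 * ∑ u ∈ bᶜ.filter (fun u => (π u : ℕ) < k), ((k : ℝ) - ((π u : ℕ) : ℝ)) * (1 - X a u) +
  lam / 2 * ∑ u ∈ bᶜ.filter (fun u => ¬ (π u : ℕ) < k), (((π u : ℕ) : ℝ) + 1 - k) * X a u

/-- ★ SLICE TRANSFER: on the slice `|a| = k` the located-pencil column equals the cube polynomial of `b` with reliefs `(λ/2)·dist` plus the explicit slack. -/
theorem col_eq {a : Finset (Fin n)} (hk : a.card = k) :
    ((1 : ℝ) - ((a ∩ b).card : ℝ)) ^ 2 + lam * (inv a π : ℝ) =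
      cubeF (posLT π k) (relief lam π k) b 0 a + slack lam π k b a := by
  classical
  have h1 := inv_I1 π hk
  have h2 := inv_I2 π hk
  have hP : ∀ u : Fin n, u ∈ posLT π k ↔ (π u : ℕ) < k := fun u => by simp [posLT]
  have splitP : ∀ f : Fin n → ℝ, ∑ u ∈ Finset.univ.filter (fun u : Fin n => (π u : ℕ) < k), f u =
      ∑ u ∈ b.filter (fun u => (π u : ℕ) < k), f u + ∑ u ∈ bᶜ.filter (fun u => (π u : ℕ) < k), f u := by
    intro f
    rw [Finset.sum_filter, Finset.sum_filter, Finset.sum_filter, Finset.sum_add_sum_compl]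
  have splitN : ∀ f : Fin n → ℝ, ∑ u ∈ Finset.univ.filter (fun u : Fin n => ¬ (π u : ℕ) < k), f u =
      ∑ u ∈ b.filter (fun u => ¬ (π u : ℕ) < k), f u + ∑ u ∈ bᶜ.filter (fun u => ¬ (π u : ℕ) < k), f u := by
    intro f
    rw [Finset.sum_filter, Finset.sum_filter, Finset.sum_filter, Finset.sum_add_sum_compl]
  have hR : ∑ u ∈ b, relief lam π k u * lit (posLT π k) u a =
      lam / 2 * ∑ u ∈ b.filter (fun u => (π u : ℕ) < k), ((k : ℝ) - ((π u : ℕ) : ℝ)) * (1 - X a u) +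
      lam / 2 * ∑ u ∈ b.filter (fun u => ¬ (π u : ℕ) < k), (((π u : ℕ) : ℝ) + 1 - k) * X a u := by
    rw [← Finset.sum_filter_add_sum_filter_not b (fun u : Fin n => (π u : ℕ) < k), Finset.mul_sum, Finset.mul_sum]
    congr 1
    · refine Finset.sum_congr rfl fun u hu => ?_
      have hu' : (π u : ℕ) < k := (Finset.mem_filter.mp hu).2
      simp [relief, lit, hu', (hP u).mpr hu']; ring
    · refine Finset.sum_congr rfl fun u hu => ?_
      have hu' : ¬ (π u : ℕ) < k := (Finset.mem_filter.mp hu).2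
      have huP : u ∉ posLT π k := fun h => hu' ((hP u).mp h)
      simp [relief, lit, hu', huP]
      ring
  have hQ : ((1 : ℝ) - ((a ∩ b).card : ℝ)) ^ 2 = (1 - ∑ u ∈ b, X a u) ^ 2 := by rw [sum_X]
  have hinv : lam * (inv a π : ℝ) =
      lam / 2 * (∑ l' ∈ posLT π k, ((k : ℝ) - ((π l' : ℕ) : ℝ)) * (1 - X a l') +
        ∑ l' ∈ posLT π k, ∑ j ∈ Finset.univ.filter (fun j => π j < π l'), (1 - X a j) * (1 - X a l') +
        ∑ l' ∈ Finset.univ.filter (fun l' : Fin n => ¬ ((π l' : ℕ) < k)),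
          ∑ l ∈ Finset.univ.filter (fun l => π l' < π l), (1 - X a l') * X a l) +
      lam / 2 * (∑ l ∈ Finset.univ.filter (fun l : Fin n => ¬ ((π l : ℕ) < k)), ((((π l : ℕ) : ℝ) + 1 - k) * X a l) +
        ∑ l ∈ Finset.univ.filter (fun l : Fin n => ¬ ((π l : ℕ) < k)),
          ∑ j ∈ Finset.univ.filter (fun j => π l < π j), X a l * X a j +
        ∑ l ∈ posLT π k, ∑ j ∈ Finset.univ.filter (fun j => π j < π l), X a l * (1 - X a j)) := by
    rw [← h1, ← h2]; ring
  have hA := splitP (fun u => ((k : ℝ) - ((π u : ℕ) : ℝ)) * (1 - X a u))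
  have hB := splitN (fun u => (((π u : ℕ) : ℝ) + 1 - k) * X a u)
  rw [hQ, hinv]
  unfold cubeF slack
  rw [hR]
  rw [show posLT π k = Finset.univ.filter (fun u : Fin n => (π u : ℕ) < k) from rfl]
  linear_combination (lam / 2) * hA + (lam / 2) * hB

/-- the NEAR set: elements of `b` whose relief is `< 1` (distance `< 2/λ` from the cut) -/
def near : Finset (Fin n) := b.filter (fun u => relief lam π k u < 1)

variable {lam}

/-- Port helper `relief_nonneg` (statement and proof verbatim from the crux workfile; see the file header). -/
theorem relief_nonneg (hlam : 0 < lam) (u : Fin n) : 0 ≤ relief lam π k u := by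
  unfold relief
  split_ifs with h
  · have : ((π u : ℕ) : ℝ) + 1 ≤ (k : ℝ) := by exact_mod_cast h
    nlinarith
  · push Not at h
    have : (k : ℝ) ≤ ((π u : ℕ) : ℝ) := by exact_mod_cast h
    nlinarith

/-- at most `2T − 2` elements are near when `λT ≥ 2` (their positions lie in an integer interval of that length) -/
theorem near_card (hlam : 0 < lam) {T : ℕ} (hT : 2 ≤ lam * T) : (near lam π k b).card ≤ 2 * T - 2 := by
  classical
  have key : ∀ u ∈ near lam π k b, (π u : ℕ) ∈ Finset.Ico (k + 1 - T) (k + T - 1) := by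
    intro u hu
    have hr : relief lam π k u < 1 := (Finset.mem_filter.mp hu).2
    rw [Finset.mem_Ico]
    unfold relief at hr
    split_ifs at hr with hp
    · have hlt : ((k : ℝ) - ((π u : ℕ) : ℝ)) < T := by
        by_contra hc
        push Not at hc
        have : lam / 2 * (T : ℝ) ≤ lam / 2 * ((k : ℝ) - ((π u : ℕ) : ℝ)) :=
          mul_le_mul_of_nonneg_left hc (by linarith)
        linarith
      have h' : (k : ℝ) < ((π u : ℕ) : ℝ) + T := by linarith
      have h'' : k < (π u : ℕ) + T := by exact_mod_cast h'
      constructor <;> omega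
    · push Not at hp
      have hlt : (((π u : ℕ) : ℝ) + 1 - k) < T := by
        by_contra hc
        push Not at hc
        have : lam / 2 * (T : ℝ) ≤ lam / 2 * (((π u : ℕ) : ℝ) + 1 - k) :=
          mul_le_mul_of_nonneg_left hc (by linarith)
        linarith
      have h' : ((π u : ℕ) : ℝ) + 1 < (k : ℝ) + T := by linarith
      have h'' : (π u : ℕ) + 1 < k + T := by exact_mod_cast h'
      constructor <;> omega
  calc (near lam π k b).card ≤ (Finset.Ico (k + 1 - T) (k + T - 1)).card :=
        Finset.card_le_card_of_injOn (fun u => (π u : ℕ)) key (fun u _ v _ h => π.injective (Fin.ext h))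
    _ = (k + T - 1) - (k + 1 - T) := Nat.card_Ico _ _
    _ ≤ 2 * T - 2 := by omega

/-- Port helper `slack_inCone` (statement and proof verbatim from the crux workfile; see the file header). -/
theorem slack_inCone (hlam : 0 < lam) : InCone 2 (slack lam π k b) := by
  have hl : 0 ≤ lam / 2 := by linarith
  refine InCone.add (InCone.add (InCone.add (InCone.smul hl (InCone.add ?_ ?_)) (InCone.smul hl (InCone.add ?_ ?_)))
    (InCone.smul hl ?_)) (InCone.smul hl ?_)
  · exact InCone.sum _ _ fun l' _ => InCone.sum _ _ fun j _ => InCone.NXNX j l'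
  · exact InCone.sum _ _ fun l' _ => InCone.sum _ _ fun l _ => InCone.mulNX l' (InCone.litX l)
  · exact InCone.sum _ _ fun l _ => InCone.sum _ _ fun j _ => InCone.XX l j
  · exact InCone.sum _ _ fun l _ => InCone.sum _ _ fun j _ => InCone.mulX l (InCone.litNX j)
  · refine InCone.sum _ _ fun u hu => (InCone.smul ?_ (InCone.litNX u)).mono (by norm_num)
    have h : (π u : ℕ) < k := (Finset.mem_filter.mp hu).2
    have : ((π u : ℕ) : ℝ) + 1 ≤ (k : ℝ) := by exact_mod_cast h
    linarith
  · refine InCone.sum _ _ fun u hu => (InCone.smul ?_ (InCone.litX u)).mono (by norm_num)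
    have h : ¬ (π u : ℕ) < k := (Finset.mem_filter.mp hu).2
    push Not at h
    have : (k : ℝ) ≤ ((π u : ℕ) : ℝ) := by exact_mod_cast h
    linarith

/-- ★ the certified column: cube theorem on the near set + slack, degree `2T` -/
theorem col_inCone (hlam : 0 < lam) {T : ℕ} (hT : 2 ≤ lam * T) :
    InCone (2 * T) (fun a => cubeF (posLT π k) (relief lam π k) b 0 a + slack lam π k b a) := by
  have hT1 : 1 ≤ T := by
    by_contra h
    push Not at h
    have : T = 0 := by omega
    subst this
    simp at hT
    linarith
  have hcube : InCone ((near lam π k b).card + 2) (cubeF (posLT π k) (relief lam π k) b 0) :=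
    cubeF_inCone (P := posLT π k) (c := relief lam π k) (near lam π k b) b 0 (Finset.filter_subset _ _) le_rfl
      (fun u _ => relief_nonneg π k hlam u)
      (fun u hu hN => by
        by_contra h
        push Not at h
        exact hN (Finset.mem_filter.mpr ⟨hu, h⟩))
  have hN := near_card π k b hlam hT
  exact InCone.add (hcube.mono (by omega)) ((slack_inCone π k b hlam).mono (by omega))

/-- the column certificate as an explicit nonnegative coefficient function on slots of degree `≤ 2T` -/
theorem col_cert (hlam : 0 < lam) {T : ℕ} (hT : 2 ≤ lam * T) :
    ∃ cf : Finset (Fin n) × Finset (Fin n) → ℝ, (∀ p, 0 ≤ cf p) ∧ (∀ p, 2 * T < p.1.card + p.2.card → cf p = 0) ∧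
      ∀ a : Finset (Fin n), a.card = k →
        ((1 : ℝ) - ((a ∩ b).card : ℝ)) ^ 2 + lam * (inv a π : ℝ) = ∑ p, cf p * cj p.1 p.2 a := by
  obtain ⟨cf, h0, hd, he⟩ := (col_inCone π k b hlam hT).coeffs
  exact ⟨cf, h0, hd, fun a hk => by rw [col_eq lam π k b hk]; exact he a⟩

end Column

/-- slot type of the factorization: size class × (positive literals, negative literals) -/
abbrev Slot (n : ℕ) := Fin (n + 1) × (Finset (Fin n) × Finset (Fin n))

/-- ★★★ **THEOREM T1 (kernel): the located permutahedron pencil is clique-blind at EVERY real `λ > 0`.**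
For every `n`, every real `λ > 0` and every natural `T` with `λT ≥ 2` there are NONNEGATIVE `U`, `V` over the slot type
`Fin (n+1) × (Finset (Fin n) × Finset (Fin n))` with `(1 − |a∩b|)² + λ·inv(a;π) = Σ_s U a s · V (b,π) s` for ALL rows `a ⊆ [n]` and ALL
columns `(b, π)`, where the row factor `U a (k, S, T′)` vanishes unless `|S| + |T′| ≤ 2T` (and then is the conjunction `[|a| = k][S ⊆ a][T′ ∩ a = ∅]`):
only `(n+1)·Σ_{d ≤ 2T} 2^d·C(n,d) = n^{O(1/λ)}` slots are live.  (`T = ⌈2/λ⌉`; memo `RealLambda39.md` THM T1, uniform strategy.) -/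
theorem real_rankPlus_le (n : ℕ) (lam : ℝ) (hlam : 0 < lam) (T : ℕ) (hT : 2 ≤ lam * T) :
    ∃ (U : Finset (Fin n) → Slot n → ℝ) (V : Finset (Fin n) × Equiv.Perm (Fin n) → Slot n → ℝ),
      (∀ a s, 0 ≤ U a s) ∧ (∀ bπ s, 0 ≤ V bπ s) ∧
      (∀ a s, U a s ≠ 0 → s.2.1.card + s.2.2.card ≤ 2 * T) ∧
      ∀ (a b : Finset (Fin n)) (π : Equiv.Perm (Fin n)),
        ((1 : ℝ) - ((a ∩ b).card : ℝ)) ^ 2 + lam * (inv a π : ℝ) = ∑ s, U a s * V (b, π) s := by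
  classical
  choose cf h0 hd he using
    fun (π : Equiv.Perm (Fin n)) (k : ℕ) (b : Finset (Fin n)) => col_cert (lam := lam) π k b hlam hT
  refine ⟨fun a s => if a.card = (s.1 : ℕ) ∧ s.2.1.card + s.2.2.card ≤ 2 * T then cj s.2.1 s.2.2 a else 0,
    fun bπ s => cf bπ.2 (s.1 : ℕ) bπ.1 s.2, ?_, ?_, ?_, ?_⟩
  · intro a s
    dsimp only
    split_ifs
    · exact cj_nonneg _ _ _
    · exact le_rfl
  · intro bπ s
    exact h0 _ _ _ _
  · intro a s h
    dsimp only at h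
    split_ifs at h with hc
    · exact hc.2
    · exact absurd rfl h
  · intro a b π
    have hkn : a.card < n + 1 := by
      have : a.card ≤ n := by simpa using Finset.card_le_univ a
      omega
    rw [Fintype.sum_prod_type, Finset.sum_eq_single (⟨a.card, hkn⟩ : Fin (n + 1))]
    · rw [he π a.card b a rfl]
      refine Finset.sum_congr rfl fun p _ => ?_
      dsimp only
      by_cases hp : p.1.card + p.2.card ≤ 2 * T
      · simp only [hp, and_true, if_true]
        ring
      · have hz := hd π a.card b p (by omega)
        simp [hp, hz]
    · intro k _ hk
      have hne : a.card ≠ (k : ℕ) := fun e => hk (Fin.ext e.symm)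
      simp [hne]
    · intro h
      exact absurd (Finset.mem_univ _) h

end

end Summit.ValiantsHypothesis.Theorems.NNDivisionHardNegative.RealLambda
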